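import Summits.Ventures.PercRepro.LineC

/-!
# PercRepro — LINE C′: the ∃-forms of contraction monotonicity, and the all-monotone version (typer-2, gen 4)

The `∀k` form of (MC_B) is false for abstract single-merge maps at `d = 8` (p4 08:01:27Z); the
dimension induction of `LineC.lean` only consumes ONE coordinate per map (lead 08:03:10Z (2)), and it
never uses the single-merge hypothesis (ASSIGNMENTS v30 (b)):

* **`SingleMergeContractionMonoChoice`** (∃k for single-merge maps), **`C005_of_contractionMonoChoice`**;
* **`ClassContractionMonoChoice`** (∃e per class of a marked multigraph),
  **`C005_of_classContractionMonoChoice`**;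
* **`MonotoneContractionMonoChoice`** (∃k for ALL monotone maps — the lead's ALLMONO),
  **`lemmaB_monotone_of_contractionMonoChoice`**, **`C005abstract_of_monotoneLemmaB`**,
  **`C005_of_monotoneContractionMonoChoice`**.
-/

namespace PercRepro

open Finset

/-! ### LINE C′: the ∃-forms (one coordinate per map / one free edge per class suffices) -/

/-- **(MC_B) in the ∃k form** (lead 08:03:10Z, LINE C′): every single-merge map on a NONEMPTY cube
has SOME coordinate whose top facet does not increase `CS_B`. -/
def SingleMergeContractionMonoChoice : Prop :=
  ∀ {S : Type} [Fintype S] [DecidableEq S] [Nonempty S] (c : Config S → Setoid (Fin 4)),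
    SingleMergeMap c → ∃ k : S, cubeSumB (facetTop c k) ≤ cubeSumB c

/-- The ∃k form gives Lemma B for every single-merge map (the same induction, one coordinate per
map). -/
theorem lemmaB_singleMerge_of_contractionMonoChoice (h : SingleMergeContractionMonoChoice) :
    ∀ {S : Type} [Fintype S] [DecidableEq S] (c : Config S → Setoid (Fin 4)), SingleMergeMap c →
      0 ≤ cubeSumB c := by
  intro S _ _ c hc
  suffices key : ∀ n : ℕ, ∀ (S : Type) [Fintype S] [DecidableEq S], Fintype.card S = n →
      ∀ c : Config S → Setoid (Fin 4), SingleMergeMap c → 0 ≤ cubeSumB c from key _ S rfl c hc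
  intro n
  induction n with
  | zero =>
    intro S _ _ hS c _
    have hempty : IsEmpty S := Fintype.card_eq_zero_iff.mp hS
    unfold cubeSumB cubeSum
    refine Finset.sum_nonneg fun ρ _ => ?_
    have hρ : ρᶜ = ρ := funext fun s => hempty.elim s
    rw [hρ, nestedKernel_self]
  | succ n ih =>
    intro S _ _ hS c hc
    haveI : Nonempty S := Fintype.card_pos_iff.mp (by omega)
    obtain ⟨k, hk⟩ := h c hc
    have hcard : Fintype.card {s // s ≠ k} = n := by
      have := Fintype.card_subtype_compl (fun s : S => s = k)
      rw [Fintype.card_subtype_eq, hS] at this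
      simpa using this
    exact le_trans (ih _ hcard (facetTop c k) (facetTop_singleMergeMap hc k)) hk

/-- **LINE C′ closes C-005.** -/
theorem C005_of_contractionMonoChoice (h : SingleMergeContractionMonoChoice) : C005 :=
  C005_of_singleMergeLemmaB (lemmaB_singleMerge_of_contractionMonoChoice h)

/-- **Contraction monotonicity of the class sums in the ∃e form**: every class with a free edge
has SOME free edge whose sure-ing does not increase `CS_B`. -/
def ClassContractionMonoChoice : Prop :=
  ∀ {V E : Type} [Fintype E] [DecidableEq E] (G : MultiGraph V E) (m : Fin 4 → V)
    (u v : Config E), (∃ e, v e = false ∧ u e = true) →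
      ∃ e, v e = false ∧ u e = true ∧
        G.faceSumB m u (Function.update v e true) ≤ G.faceSumB m u v

/-- The `∀e` form implies the `∃e` form (any free edge will do). -/
theorem classContractionMonoChoice_of_classContractionMono (h : ClassContractionMono) :
    ClassContractionMonoChoice :=
  fun G m u v ⟨e, hv, hu⟩ => ⟨e, hv, hu, h G m u v e hv hu⟩

/-- The `∀k` form implies the `∃k` form for single-merge maps (any coordinate will do). -/
theorem singleMergeContractionMonoChoice_of_contractionMono (h : SingleMergeContractionMono) :
    SingleMergeContractionMonoChoice :=
  fun c hc => ⟨Classical.arbitrary _, h c hc _⟩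

/-- The ∃e form gives Lemma B on every class of every marked multigraph. -/
theorem faceSumB_nonneg_of_classContractionMonoChoice (h : ClassContractionMonoChoice) :
    ∀ {V E : Type} [Fintype E] [DecidableEq E] (G : MultiGraph V E) (m : Fin 4 → V)
      (u v : Config E), 0 ≤ G.faceSumB m u v := by
  intro V E _ _ G m u v
  suffices key : ∀ n : ℕ, ∀ (u v : Config E), Fintype.card (Face u v) = n → 0 ≤ G.faceSumB m u v
    from key _ u v rfl
  intro n
  induction n using Nat.strong_induction_on with
  | _ n ih =>
    intro u v hcard
    by_cases hfree : ∃ e, v e = false ∧ u e = true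
    · obtain ⟨e, hv, hu, hle⟩ := h G m u v hfree
      have hlt := card_face_update_lt u v hv hu
      rw [hcard] at hlt
      exact le_trans (ih _ hlt u _ rfl) hle
    · have : IsEmpty (Face u v) := ⟨fun x => hfree ⟨x.1, x.2⟩⟩
      rw [G.faceSumB_eq_zero_of_isEmpty m u v]

/-- **LINE C′ on graphs closes C-005.** -/
theorem C005_of_classContractionMonoChoice (h : ClassContractionMonoChoice) : C005 := by
  intro V E _ _ G p hp a b c d
  have key : 0 ≤ nestedForm p (fun ω => G.markedPartition ω ![a, b, c, d])
      (fun ω => G.markedPartition ω ![a, b, c, d]) := by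
    rw [nestedForm_self_eq_sum_faces]
    refine Finset.sum_nonneg fun uv _ => ?_
    refine mul_nonneg (mul_nonneg (weight_nonneg hp _) (weight_nonneg hp _)) ?_
    split_ifs with hle
    · exact faceSumB_nonneg_of_classContractionMonoChoice h G ![a, b, c, d] uv.1 uv.2
    · exact le_rfl
  rw [G.nestedForm_markedPartition] at key
  linarith

/-! ### LINE C′ for ALL monotone maps (ASSIGNMENTS v30 (b): the induction never used single merge) -/

section MonoChoice

variable {S : Type*} [DecidableEq S]

/-- `extendAt` is monotone in the configuration. -/
theorem extendAt_mono (k : S) (b : Bool) : Monotone (extendAt k b) := by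
  intro σ σ' h s
  by_cases hs : s = k
  · subst hs
    rw [extendAt_self, extendAt_self]
  · rw [extendAt_of_ne k b σ hs, extendAt_of_ne k b σ' hs]
    exact h _

/-- The top facet of a monotone map is monotone. -/
theorem facetTop_monotone {ι : Type*} [Preorder ι] {c : Config S → ι} (hc : Monotone c) (k : S) :
    Monotone (facetTop c k) :=
  fun _ _ h => hc (extendAt_mono k true h)

end MonoChoice

/-- **(MC_B) in the ∃k form for ALL monotone maps** (lead ALLMONO: true for all 70,363,677 monotone
maps at `d = 4`): every monotone map on a nonempty cube has SOME coordinate whose top facet does not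
increase `CS_B`. -/
def MonotoneContractionMonoChoice : Prop :=
  ∀ {S : Type} [Fintype S] [DecidableEq S] [Nonempty S] (c : Config S → Setoid (Fin 4)),
    Monotone c → ∃ k : S, cubeSumB (facetTop c k) ≤ cubeSumB c

/-- The ∃k form for monotone maps gives Lemma B for every monotone map (the dimension induction;
no single-merge hypothesis is used). -/
theorem lemmaB_monotone_of_contractionMonoChoice (h : MonotoneContractionMonoChoice) :
    ∀ {S : Type} [Fintype S] [DecidableEq S] (c : Config S → Setoid (Fin 4)), Monotone c →
      0 ≤ cubeSumB c := by
  intro S _ _ c hc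
  suffices key : ∀ n : ℕ, ∀ (S : Type) [Fintype S] [DecidableEq S], Fintype.card S = n →
      ∀ c : Config S → Setoid (Fin 4), Monotone c → 0 ≤ cubeSumB c from key _ S rfl c hc
  intro n
  induction n with
  | zero =>
    intro S _ _ hS c _
    have hempty : IsEmpty S := Fintype.card_eq_zero_iff.mp hS
    unfold cubeSumB cubeSum
    refine Finset.sum_nonneg fun ρ _ => ?_
    have hρ : ρᶜ = ρ := funext fun s => hempty.elim s
    rw [hρ, nestedKernel_self]
  | succ n ih =>
    intro S _ _ hS c hc
    haveI : Nonempty S := Fintype.card_pos_iff.mp (by omega)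
    obtain ⟨k, hk⟩ := h c hc
    have hcard : Fintype.card {s // s ≠ k} = n := by
      have := Fintype.card_subtype_compl (fun s : S => s = k)
      rw [Fintype.card_subtype_eq, hS] at this
      simpa using this
    exact le_trans (ih _ hcard (facetTop c k) (facetTop_monotone hc k)) hk

/-- **Lemma B for all monotone maps gives the abstract C-005** (`C005abstract`, Nested.lean) — and
C-005 itself. -/
theorem C005abstract_of_monotoneLemmaB
    (h : ∀ {S : Type} [Fintype S] [DecidableEq S] (c : Config S → Setoid (Fin 4)), Monotone c →
      0 ≤ cubeSumB c) : C005abstract := by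
  intro E _ _ p hp c hc
  rw [nestedForm_self_eq_sum_faces]
  refine Finset.sum_nonneg fun uv _ => ?_
  refine mul_nonneg (mul_nonneg (weight_nonneg hp _) (weight_nonneg hp _)) ?_
  split_ifs with hle
  · have hh := h (fun ρ => c (embed uv.1 uv.2 ρ)) (hc.comp (embed_mono uv.1 uv.2))
    unfold cubeSumB cubeSum at hh
    exact hh
  · exact le_rfl

/-- **LINE C′ for all monotone maps closes the abstract C-005, hence C-005.** -/
theorem C005_of_monotoneContractionMonoChoice (h : MonotoneContractionMonoChoice) : C005 :=
  MultiGraph.C005_of_C005abstract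
    (C005abstract_of_monotoneLemmaB (lemmaB_monotone_of_contractionMonoChoice h))

end PercRepro
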